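import Summits.QuantumFields.BalabanUV.T4Continuum.Support.NE7HintOfLandauMinSupSU2
import Summits.QuantumFields.BalabanUV.T4Continuum.Support.NE7HintOfCubeChartSU2DecSlice
import HarnessLib

/-!
# GEN 99 RE-THREAD (`…Slice`, Bałaban-slice road, memo `t4/b2b-balaban-t4-ne7-p1-g99/ROAD-G99.md` §3.5 ∕ §3.8): this file is `NE7HintOfLandauELChartSU2Dec`'s CHAIN THEOREM VERBATIM except that
# the slice `T_♮(U♯) = frameFreeBlockLandauW` of the per-pair binder is replaced by an ABSTRACT SLICE FAMILY `𝒯 k U♯` with the two hypotheses (hT) «tangent-critical ⟹ critical on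
# `𝒯 j W`» and (hP) «class SlicePoincare for `𝒯 j W`» in the generic theorems, and by the corner-free energy block-Landau slice `𝒯_E = energyBlockLandauW` (both hypotheses
# DISCHARGED: `hT_energyBlockLandau`, `classSlicePoincare_energyBlockLandau_SU2`, constant `8·CPLine 4 2 2 10⁻¹⁷ 10⁻⁵³ + 1`) in the SU(2) `d = 4` `L = 2` theorems; chain predecessors are
# the `…Slice` ∕ `…GenericSlice` re-issues (lineage `b2b-balaban-t4-ne7-p1` gen 99, CRUX PROVER NE7 #1).  NOT NE7; spine 0∕9.  Original docstring follows.

# GEN 95 RE-THREAD (`…Dec`): this file is `NE7HintOfLandauELChartSU2`'s CHAIN THEOREM VERBATIM except that F31's per-pair binder `hleaves` (row NE3's weight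
# currency, numerically refuted for arbitrary pairs — memo `t4/b2b-balaban-t4-ne7-p1-g95/WEIGHT-CURRENCY-DEAD.md`) is replaced by F327's honest binder `hdecomp`
# (decomposition `X = X_T + X_N` with its two energy letters and k-free currencies `(α̂, ν̂, κ̂)`) and route Π's uniform block by ONE k-free line; the chart
# content is untouched (auxiliary theorems are imported from the original files BY NAME) and chain predecessors are the `…Dec` re-issues.  Original docstring follows.

# NE7 — (8)∃ FROM ANY LOCAL GAUGE WITH THE LATTICE LANDAU CONDITION AND THE SUP LETTER, SU(2)∕U(2) on T⁴, `L = 2` (F306): the ∃-form of the chart input — around every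
# point SOME unitary gauge `u` and skew `A` with `U^{u} = e^{A}`, `‖A‖ ≤ c₀t∕M` and the lattice Landau condition (Euler–Lagrange form) on the sup-cube of radius
# `R₀ = (nbRad + 2ℓ + 12)·M + 2` — the form a CONSTRUCTED critical gauge (print's road) or the free-boundary minimiser (F304′) supplies, without any uniqueness claim

Cell `pub-balaban`, rung (B)+1 sub-cell t4, lineage `b2b-balaban-t4-ne7-p1` (CRUX PROVER NE7 #1 = OWNER of row NE7), generation 92; memo
`t4/b2b-balaban-t4-ne7-p1-g92/LOG-OBSTRUCTION.md` §4c.  Over F305 `NE7HintOfLandauMinSupSU2.cubeChart_of_landauEL`, F301, F298.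

WHY.  F305′ quantifies over ALL free-boundary minimisers («every minimiser has the sup letter») — stronger than any constructive proof delivers (a construction by
contraction, [B11] Sects. A–E at one scale, yields ONE regular critical gauge; identifying it with every minimiser would need a uniqueness theorem for the trace-link
functional on `U(n)^{Q}`).  This file states the interface in the form both roads supply: EXISTENCE of a gauge with the Landau condition and the sup letter on the cube.
F304′ shows such gauges exist modulo the sup letter; ROAD (U′) constructs one with it.
WHAT ([folklore] composition; 0 def, 0 sorry).  **`hint_of_landauELChart_SU2`**: ∀ `A ≥ 0`, `p` ∃ `ℓ ≥ 1`, `ε₀ > 0` ∀ `0 < ε ≤ ε₀` ∃ `β₀ > 0` ∀ `0 < β ≤ β₀` ∀ `N ≥ 1` ∀ `c₀ ∈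
[0, A(ℓ+1)^p]`: route Π's two lines ∧ (LSUP-EL on the `(4ℓ+64)`-fold cover) ∧ hleaves ⟹ (8)∃.
HONEST FRAMING (page 1): (LSUP-EL) is a HYPOTHESIS ([B8] Thm 2 (1.36)₁ + Landau condition TYPE at `U₀ = 1`, LOCAL; the target of ROAD (U)∕(U′) (B2)), asserted for nothing;
hleaves ([B11] Prop 2 TYPE) likewise; nothing of Bałaban's asserted as an axiom; NE7 NOT PROVED unconditionally; spine 0∕9; finite T⁴ rung (B)+1 — NOT infinite volume, NOT
mass gap, NOT `BetaPertH`, NOT Clay.  Continuum YM on T⁴ ⇐ BetaPertH ∧ nine spine estimates (0/9 proved); BetaPertH ⇐ (D1) ∧ (D4) ∧ CAP+tail; G-an2-4 gates asym, D1 and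
NE2/3/4.  No `sorry`; axioms ⊆ {propext, Classical.choice, Quot.sound}.
-/

set_option autoImplicit false

open scoped BigOperators Matrix Matrix.Norms.L2Operator Topology
open NormedSpace Finset Set Filter

namespace Summit.QuantumFields.BalabanUV.T4Continuum.NE7HintOfLandauELChartSU2DecSlice

open Literature.MathematicalPhysics.QuantumFieldTheory.Balaban1983to89
open B7Prop1Explicit B7Prop2Explicit MatrixLog UnitaryModel MatrixNorms
open B4TorusKernel.MultiPeriod (torusSupNorm)
open B8Ineq132 (covDiv)
open T4AveragingDeficitWall (Ad IsUnitaryCfg IsSkewDir SmallField vary curl curlSq dirSq dirL1)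
open T4AveragingDeficitWallBoundary (IsPeriodicCfg periodBox)
open AveragingDeficitPeriodicCounting (IsPeriodicDir)
open AveragingDeficitMultiLevelPrep (LevelSmall tower TangentIter)
open BlockAverageVaryHolo (nbRad)
open MinimalActionLevels (perWin)
open MinimalActionSandwich (IsMinimiser admissible)
open MinimalActionRate (sfClass)
open NE3HessForm (dAction)
open NE3SlicePoincareBudgetLine (CPLine)
open NE3TangentCovariantTower (dirIter)
open NE3DecomposedRepOfLinearNormalPart (ResidualSliceRepT)
open NE3QbarIterCovLiftPrep (cruxC)
open NE3SmoothRightInverseW (rightInvW)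
open NE3RightInverseSolveLetters (thetaLoc)
open NE3RightInverseL2Letter (l2C)
open NE3HatInvCurlLetters (curl2C curl1C)
open NE3EnergyShapes (IsUnitarySite)
open BlockAveragePushDirSplit (flat)
open NE7HintOfCubeChartSU2DecSlice (hint_of_cubeChart_SU2)
open NE3EnergyWeightedShapes (energyNormW)
open NE7MeanZeroGaugeSliceW (energyBlockLandauW)
open NE7EnergyBlockLandauClassPoincare (classSlicePoincare_energyBlockLandau_SU2)
open NE7ConvOneStepGenericSlice (hT_energyBlockLandau)
open NE7ClassCurrentBound (exists_classCurrentConst)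
open NE7HintOfLandauMinSupSU2 (cubeChart_of_landauEL)
open Literature.NumberTheory.Sieve.SquarefreeSums (exp_sub_one_le_two_mul)

noncomputable section

variable {n : Type*} [Fintype n] [DecidableEq n]

set_option maxHeartbeats 1600000 in
/-- **F306 — (8)∃ FROM ANY LOCAL GAUGE WITH THE LATTICE LANDAU CONDITION AND THE SUP LETTER, SU(2)∕U(2) on T⁴, `L = 2`.**  For all `A ≥ 0` and `p` there are `ℓ ≥ 1`,
`ε₀ > 0` and, for every `0 < ε ≤ ε₀`, a `β₀ > 0` such that for `0 < β ≤ β₀`, every period `N ≥ 1` and all `c₀ ∈ [0, A(ℓ+1)^p]`: IF route Π's two `k`-free lines, (LSUP-EL) —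
around every point `z` of every tangent-critical admissible configuration on the `(4ℓ+64)`-fold cover with small field `r ≤ ε∕4`: a unitary site gauge `u` and `A` with
`U^{u} = e^{A}`, `A` skew, `‖A‖ ≤ c₀t∕M` and the lattice Landau condition `Σ_κ [(W(y,κ) − W(y,κ)†) − (W(y−e_κ,κ) − W(y−e_κ,κ)†)] = 0` (`W = U^{u}`) on the sup-cube of radius
`(nbRad 4 2 + 2ℓ + 12)·2^{k+1} + 2` — and row NE3's `hleaves` hold, THEN for some `δ_V > 0`, over `{V | unitary, N-periodic, SmallField V δ_V}`, at every level some constrained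
minimiser over `sfClass 4 2 N ε` is `SmallField U a` with `0 ≤ a < ε∕(2^k)²`. [folklore] -/
theorem hint_of_landauELChart_SU2 [Nonempty n] (hn : Fintype.card n = 2) {A : ℝ} (hA : 0 ≤ A) (p : ℕ) :
    ∃ ℓ : ℕ, 1 ≤ ℓ ∧ ∃ ε₀ : ℝ, 0 < ε₀ ∧ ∀ ε : ℝ, 0 < ε → ε ≤ ε₀ → ∃ β₀ : ℝ, 0 < β₀ ∧ ∀ β : ℝ, 0 < β → β ≤ β₀ →
    ∀ (N : ℕ) [NeZero N] (αh νh κh c₀ : ℝ), 1 ≤ N →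
    -- the k-free ceilings `(α̂, ν̂, κ̂)` of the honest per-pair binder and ONE k-free strict line (F327)
    2 * κh < ((((1 / 2 - νh ^ 2) / (2 * (1 + (8 * CPLine 4 2 2 (1 / 10 ^ 17) (1 / 10 ^ 53) + 1))) - νh ^ 2) / 2 - 576 * ((4 : ℕ) : ℝ) * (αh ^ 2 * Real.exp (2 * αh))) / (Fintype.card n : ℝ) - 28 * ((4 : ℕ) : ℝ) * (ε + 7 * αh ^ 2)) →
    0 ≤ c₀ → c₀ ≤ A * ((ℓ : ℝ) + 1) ^ p →
    -- (LSUP-EL): a local gauge with the Landau condition (EL form) and the sup letter, on the `(4ℓ+64)`-fold cover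
    (∀ D : Site 4 → Fin 4 → (Matrix n n ℂ)ˣ, IsUnitaryCfg D → IsPeriodicCfg D ((N * (4 * ℓ + 64)) : ℤ) → SmallField D (4 * (Real.exp β - 1)) →
      ∀ (k : ℕ), ∀ U ∈ admissible (sfClass 4 2 (N * (4 * ℓ + 64)) ε) 2 (k + 1) D,
      (∀ φ : Site 4 → Fin 4 → Matrix n n ℂ, IsSkewDir φ → IsPeriodicDir φ (((N * (4 * ℓ + 64)) * 2 ^ (k + 1) : ℕ) : ℤ) → TangentIter 2 k U φ →
        dAction U φ (perWin 4 ((N * (4 * ℓ + 64)) * 2 ^ (k + 1))) = 0) →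
      ∀ r : ℝ, 0 ≤ r → r ≤ (1 / ((2 : ℕ) : ℝ) ^ 2 * ε) → SmallField U (r / (((2 : ℕ) : ℝ) ^ (k + 1)) ^ 2) →
      ∀ z : Site 4, ∃ (u : Site 4 → (Matrix n n ℂ)ˣ) (A : Site 4 → Fin 4 → Matrix n n ℂ), (∀ x, u x ∈ unitaryUnits (Matrix n n ℂ)) ∧
        (∀ (p : Site 4) (μ : Fin 4), (∀ i, |p i - z i| ≤ (((nbRad 4 2 + 2 * ℓ + 12) * 2 ^ (k + 1) + 2 : ℕ) : ℤ)) → gaugeAct u U p μ = expUnit (A p μ)) ∧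
        (∀ (p : Site 4) (μ : Fin 4), (∀ i, |p i - z i| ≤ (((nbRad 4 2 + 2 * ℓ + 12) * 2 ^ (k + 1) + 2 : ℕ) : ℤ)) → A p μ ∈ skewAdjoint (Matrix n n ℂ)) ∧
        (∀ (p : Site 4) (μ : Fin 4), (∀ i, |p i - z i| ≤ (((nbRad 4 2 + 2 * ℓ + 12) * 2 ^ (k + 1) + 2 : ℕ) : ℤ)) → ‖A p μ‖ ≤ c₀ * (r + 4 * (Real.exp β - 1) + ε) / ((2 : ℕ) : ℝ) ^ (k + 1)) ∧
        (∀ (y : Site 4), (∀ i, |y i - z i| ≤ (((nbRad 4 2 + 2 * ℓ + 12) * 2 ^ (k + 1) + 2 : ℕ) : ℤ)) →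
          ∑ κ : Fin 4, ((((gaugeAct u U y κ : (Matrix n n ℂ)ˣ) : Matrix n n ℂ) - ((gaugeAct u U y κ : (Matrix n n ℂ)ˣ) : Matrix n n ℂ)ᴴ)
            - (((gaugeAct u U (y - e κ) κ : (Matrix n n ℂ)ˣ) : Matrix n n ℂ) - ((gaugeAct u U (y - e κ) κ : (Matrix n n ℂ)ˣ) : Matrix n n ℂ)ᴴ)) = 0)) →
    -- THE HONEST PER-PAIR BINDER `hdecomp` on the data class (F327's)
    (∀ D : Site 4 → Fin 4 → (Matrix n n ℂ)ˣ, IsUnitaryCfg D → IsPeriodicCfg D (N : ℤ) → SmallField D (4 * (Real.exp β - 1)) → ∀ (k : ℕ), ∀ Us ∈ admissible (sfClass 4 2 N ε) 2 (k + 1) D, SmallField Us ((1 / ((2 : ℕ) : ℝ) ^ 2 * ε / 2) / (((2 : ℕ) : ℝ) ^ (k + 1)) ^ 2) → (∀ φ : Site 4 → Fin 4 → Matrix n n ℂ, IsSkewDir φ → IsPeriodicDir φ ((N * 2 ^ (k + 1) : ℕ) : ℤ) → TangentIter 2 k Us φ → dAction Us φ (perWin 4 (N * 2 ^ (k + 1)))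 = 0) → ∀ U' ∈ admissible (sfClass 4 2 N ε) 2 (k + 1) D, 
      ∃ (u : Site 4 → (Matrix n n ℂ)ˣ) (X XT XN : Site 4 → Fin 4 → Matrix n n ℂ) (α ν κ : ℝ),
        IsUnitarySite u ∧ IsSkewDir X ∧ IsPeriodicDir X ((N * 2 ^ (k + 1) : ℕ) : ℤ) ∧ 0 ≤ α ∧ (∀ x μ, ‖X x μ‖ ≤ α) ∧
        gaugeAct u U' = vary Us X 1 ∧
        X = XT + XN ∧ XT ∈ energyBlockLandauW (d := 4) (n := n) 2 N (k + 1) Us ∧ IsSkewDir XN ∧ 0 ≤ ν ∧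
        energyNormW 2 (k + 1) Us XN (periodBox (d := 4) (N * 2 ^ (k + 1)))
          ≤ ν * energyNormW 2 (k + 1) Us X (periodBox (d := 4) (N * 2 ^ (k + 1))) ∧
        ε / (((2 : ℕ) : ℝ) ^ (k + 1)) ^ 2 * (∑ p ∈ perWin 4 (N * 2 ^ (k + 1)), ‖curl Us XN p‖)
          ≤ κ * energyNormW 2 (k + 1) Us X (periodBox (d := 4) (N * 2 ^ (k + 1))) ^ 2 ∧
        α * ((2 : ℕ) : ℝ) ^ (k + 1) ≤ αh ∧ ν ≤ νh ∧ κ ≤ κh) →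
    ∃ δV : ℝ, 0 < δV ∧
      ∀ V ∈ {V : Site 4 → Fin 4 → (Matrix n n ℂ)ˣ | IsUnitaryCfg V ∧ IsPeriodicCfg V (N : ℤ) ∧ SmallField V δV},
      ∀ k : ℕ, ∃ U : Site 4 → Fin 4 → (Matrix n n ℂ)ˣ, IsMinimiser 4 (sfClass 4 2 N ε) 2 N k V U ∧
        ∃ a : ℝ, 0 ≤ a ∧ a < ε / (((2 : ℕ) : ℝ) ^ k) ^ 2 ∧ SmallField U a := by
  obtain ⟨C, hC0, hC⟩ := exists_classCurrentConst (n := n)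
  set A' : ℝ := 62 * A + 1024 * (2 * C + 48) + 34816 * A with hA'
  have hA'0 : 0 ≤ A' := by positivity
  obtain ⟨ℓ, hℓ1, ε₀, hε₀, H⟩ := hint_of_cubeChart_SU2 (n := n) hn (A := A') hA'0 (p + 2)
  have hℓ0 : (0 : ℝ) ≤ (ℓ : ℝ) := Nat.cast_nonneg ℓ
  set T : ℝ := 1 / (1152 * (2 * (ℓ : ℝ) + 32) * (A * ((ℓ : ℝ) + 1) ^ p + 1)) with hT
  have hT0 : 0 < T := by positivity
  refine ⟨ℓ, hℓ1, min ε₀ (min (1 / 10 ^ 53) (T / 3)), lt_min hε₀ (lt_min (by norm_num) (by positivity)), fun ε hε hεle => ?_⟩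
  obtain ⟨β₀, hβ₀, H2⟩ := H ε hε (hεle.trans (min_le_left _ _))
  refine ⟨min β₀ (min 1 (T / 24)), lt_min hβ₀ (lt_min one_pos (by positivity)), ?_⟩
  intro β hβ hβle N _ αh νh κh c₀ hN hline hc₀ hc₀b hLSUP hdecomp
  have hε53 : ε ≤ 1 / 10 ^ 53 := hεle.trans ((min_le_right _ _).trans (min_le_left _ _))
  have hεT : ε ≤ T / 3 := hεle.trans ((min_le_right _ _).trans (min_le_right _ _))
  have hβ1 : β ≤ 1 := hβle.trans ((min_le_right _ _).trans (min_le_left _ _))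
  have hβT : β ≤ T / 24 := hβle.trans ((min_le_right _ _).trans (min_le_right _ _))
  have hexpβ : 4 * (Real.exp β - 1) ≤ T / 3 := by
    have h := exp_sub_one_le_two_mul hβ.le hβ1; linarith
  set c₁ : ℝ := 62 * c₀ + (2 * (ℓ : ℝ) + 32) ^ 2 * (2 * C + 32 * c₀ + 48 + 2 * 0) with hc₁
  have hc₁0 : 0 ≤ c₁ := by positivity
  have hpow2 : ((ℓ : ℝ) + 1) ^ p ≤ ((ℓ : ℝ) + 1) ^ (p + 2) := pow_le_pow_right₀ (by linarith) (by omega)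
  have hsq : (2 * (ℓ : ℝ) + 32) ^ 2 ≤ 1024 * ((ℓ : ℝ) + 1) ^ 2 := by nlinarith
  have hpow_eq : ((ℓ : ℝ) + 1) ^ (p + 2) = ((ℓ : ℝ) + 1) ^ 2 * ((ℓ : ℝ) + 1) ^ p := by ring
  have hQ : 0 ≤ A * ((ℓ : ℝ) + 1) ^ p := by positivity
  have hc₁b : c₁ ≤ A' * ((ℓ : ℝ) + 1) ^ (p + 2) := by
    have h1 : 2 * C + 32 * c₀ + 48 + 2 * 0 ≤ 2 * C + 48 + 34 * (A * ((ℓ : ℝ) + 1) ^ p) := by linarith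
    have h2 : (2 * (ℓ : ℝ) + 32) ^ 2 * (2 * C + 32 * c₀ + 48 + 2 * 0) ≤ (1024 * ((ℓ : ℝ) + 1) ^ 2) * (2 * C + 48 + 34 * (A * ((ℓ : ℝ) + 1) ^ p)) :=
      mul_le_mul hsq h1 (by positivity) (by positivity)
    have h3 : 62 * c₀ ≤ 62 * A * ((ℓ : ℝ) + 1) ^ (p + 2) := by nlinarith
    have h4 : (1024 * ((ℓ : ℝ) + 1) ^ 2) * (2 * C + 48 + 34 * (A * ((ℓ : ℝ) + 1) ^ p))
        = 1024 * (2 * C + 48) * ((ℓ : ℝ) + 1) ^ 2 + 34816 * A * ((ℓ : ℝ) + 1) ^ (p + 2) := by rw [hpow_eq]; ring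
    have h5 : 1024 * (2 * C + 48) * ((ℓ : ℝ) + 1) ^ 2 ≤ 1024 * (2 * C + 48) * ((ℓ : ℝ) + 1) ^ (p + 2) := by
      have : ((ℓ : ℝ) + 1) ^ 2 ≤ ((ℓ : ℝ) + 1) ^ (p + 2) := pow_le_pow_right₀ (by linarith) (by omega)
      exact mul_le_mul_of_nonneg_left this (by positivity)
    rw [hc₁, hA']; nlinarith
  have hc₀b' : c₀ ≤ A' * ((ℓ : ℝ) + 1) ^ (p + 2) := by
    have h1 : A * ((ℓ : ℝ) + 1) ^ p ≤ A * ((ℓ : ℝ) + 1) ^ (p + 2) := mul_le_mul_of_nonneg_left hpow2 hA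
    have h2 : A * ((ℓ : ℝ) + 1) ^ (p + 2) ≤ A' * ((ℓ : ℝ) + 1) ^ (p + 2) := by
      apply mul_le_mul_of_nonneg_right _ (by positivity); rw [hA']; nlinarith
    linarith
  refine H2 β hβ (hβle.trans (min_le_left _ _)) N αh νh κh c₀ c₁ hN hline hc₀ hc₀b' hc₁0 hc₁b ?_ hdecomp
  intro D hDu hDP hDs k U hU hcrit r hr0 hr hUr z
  haveI : NeZero (N * (4 * ℓ + 64)) := ⟨mul_ne_zero (NeZero.ne N) (by omega)⟩
  have hr4 : r ≤ ε / 4 := by have e := hr; norm_num at e; linarith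
  have hr14 : r ≤ 1 / 4 := by linarith [hε53.trans (by norm_num : (1 : ℝ) / 10 ^ 53 ≤ 1)]
  have hcur := hC (N * (4 * ℓ + 64)) ε hε hε53 D k U hU hcrit r hr0 hr14 hUr
  obtain ⟨u, A₀, hu, hUA, hskew, hA0, hEL⟩ := hLSUP D hDu hDP hDs k U hU hcrit r hr0 hr hUr z
  have ht : r + 4 * (Real.exp β - 1) + ε ≤ 1 / (1152 * (2 * (ℓ : ℝ) + 32) * (c₀ + 1)) := by
    have h1 : r + 4 * (Real.exp β - 1) + ε ≤ T := by linarith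
    have h2 : T ≤ 1 / (1152 * (2 * (ℓ : ℝ) + 32) * (c₀ + 1)) := by
      rw [hT]; apply div_le_div_of_nonneg_left (by norm_num) (by positivity)
      exact mul_le_mul_of_nonneg_left (by linarith) (by positivity)
    linarith
  have hsub : ∀ (q : Site 4), (∀ i, |q i - z i| ≤ (((nbRad 4 2 + 2 * ℓ + 11) * 2 ^ (k + 1) : ℕ) : ℤ)) →
      ∀ i, |q i - z i| ≤ (((nbRad 4 2 + 2 * ℓ + 12) * 2 ^ (k + 1) + 2 : ℕ) : ℤ) := fun q hq i =>
    (hq i).trans (by push_cast; nlinarith [show (1 : ℤ) ≤ 2 ^ (k + 1) by exact_mod_cast Nat.one_le_two_pow])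
  refine ⟨u, A₀, hu, fun q μ hq => hUA q μ (hsub q hq), fun q μ hq => hskew q μ (hsub q hq), fun q μ hq => hA0 q μ (hsub q hq), fun q μ τ hq _ => ?_⟩
  exact cubeChart_of_landauEL (n := n) ℓ k hr0 hε.le hβ.le hc₀ hC0 ht hUr hcur hu z hUA hskew hA0 hEL q μ τ hq

end

end Summit.QuantumFields.BalabanUV.T4Continuum.NE7HintOfLandauELChartSU2DecSlice
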